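/-
Copyright (c) 2026 the pub-hodgecm-mathlib formalisation cell (harness21).  Prover seat hodgecm-mathlib-R90-C131-p05 (g0), HCML SLAB R90-TF,
section S4 «Ch. 13.1–2» (dealer K2E2-plan (g6)), ROAD «KEYS2-ANALYTIC» (MEMO `R90/R90-C131-p05/g0/MEMO-KEYS2-analytic-road.v1.md`), brick (ζ)
FILE B «KEYS (2) ANALYTIC HALF» — the closing file: sub-sub-socket `stub_R90_S4_U2_ldsRed` of `Lines/R90_S4_HPacketsU2B.lean` ED. 5 PROVED.  2026-09-04/05.
-/
import Summits.HodgeConjecture.HodgeConjecture.Theorems.R90S4Keys2AnnulusDock                   -- ★ (this seat) (ζ) FILE A: `integral_cellFun_testVector_eq_zero_two`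
import Summits.HodgeConjecture.HodgeConjecture.Theorems.R90S4Keys2JacquetSemisimple              -- ★ (α) (R90-C131-p04): `secondEigenfunctional_of_one_vector_two`, `cmTwo_weylTorusCharPair_eq_of_isQuadraticCharExtension`
import Summits.HodgeConjecture.HodgeConjecture.Theorems.R90S4Keys2SplitTest                      -- ★ (β) (R90-C14-p04): `pair_two_normalizedJacquet_mk_eq_smul_of_forall_integral_eq_zero`
import Summits.HodgeConjecture.HodgeConjecture.Theorems.F0P3cStCharTSRedOfEigenfunctional        -- ★ «KEYS-RED ⟸ SECOND EIGENFUNCTIONAL★» `exists_ne_bot_ne_top_of_eigenfunctional L N v` (generic `N`)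
import Summits.HodgeConjecture.HodgeConjecture.Theorems.R90S4HLdsTwoOfDecomposable               -- ★ p862152 (this seat): `continuous_unitsCoe_of_isOpen_ker`
import Literature.NumberTheory.Automorphic.CMPrincipalSeriesJacquetEvalOne                       -- ★ `exists_cmPrincipalSeries_toFun_one_eq_one L 2 v` (the standard section `f₀(1) = 1`)
import HarnessLib

/-!
# R90-TF · S4 — ROAD «KEYS2-ANALYTIC», CLOSING FILE «KEYS (2) ANALYTIC HALF★»: at a non-split `v`, for smooth `χ₁, χ₂` with `χ₁|F_v^× = ω_{E/F}`, the
# principal series `i_{U(Φ₂)}((χ₁, χ₂))` is REDUCIBLE — sub-sub-socket `stub_R90_S4_U2_ldsRed` (B ED. 5 :413) PROVED, hence (with ★ p862353, ★ p862152)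
# the sub-sockets `_ldsDecomp` and `_ldsTwo` of `Lines/R90_S4_HPacketsU2B.lean` are theorems

Cell `hodgecm-mathlib`, crux H413 (`stmt-HodgeConjecture-24833`, lane `--supports … --as helper`), route of record `HCCMUnconditional` (no route verbs;
count-neutral).  Programme R90-TF, section S4 (Rogawski Ch. 13.1–2, base `R90-C131`); seat R90-C131-p05 (g0).  THEOREMS ONLY (no `def`, no instance,
no notation, no named fact, no `sorry`); imports ★ only.  The `N = 2` twin of ★ `F0P3cStCharTSKeys3AnalyticHalf` §2.

THE ARGUMENT ([Rogawski1990, §11.1 p. 161, §12.1 p. 171]; [Keys1984, §3, §7]; [Casselman1995, §6.3–6.4, Lemma 7.1.1 (a)]; [LabesseLanglands1979]).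
`χ₁|F_v^× = ω` makes `χ = (χ₁, χ₂)` `w`-FIXED (★ (α) `cmTwo_weylTorusCharPair_eq_of_isQuadraticCharExtension`).  Take the standard section `f₀`, `f₀(1) = 1`
(★ `exists_cmPrincipalSeries_toFun_one_eq_one`), any Haar measure `μ` of `N₂(L⁺_v)` and the Weyl element `w₀` of matrix `Φ₂` (★ `exists_weylElt_two`).  For every
`m ∈ T₂` the cell integral of the Jacquet test vector `δ^{-1/2}(m)·(m·f₀) − χ(m)·f₀` VANISHES (★ (ζ) FILE A `integral_cellFun_testVector_eq_zero_two`: annulus formula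
on norm balls + «ANNULUS VANISHING» ⟸ «TAIL VANISHING» ⟸ the dilation law by the OUTER similitude `diag(t₀, 1)`, `t₀` a non-norm fixed unit, `χ₁ t₀ = −1`), so by the
split test (★ (β)) `r_{B₂}(m)[f₀] = χ(m)[f₀]` for all `m`; by ★ (α) the Jacquet module is `χ`-isotypic and `i((χ₁, χ₂))` carries a `(B₂, χδ^{1/2})`-eigenfunctional not
proportional to `ev₁`; by ★ «KEYS-RED ⟸ SECOND EIGENFUNCTIONAL» (Frobenius + admissibility + Schur on a `K`-fixed space) `i((χ₁, χ₂))` has a `G`-stable `⊥ ≠ N ≠ ⊤`.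
* §1 **`hSecond_two_holds`** — the two hypotheses of ★ `exists_ne_bot_ne_top_of_eigenfunctional L 2 v (χ₁, χ₂)`, for continuous `χ₁, χ₂` with `χ₁|F_v^× = ω`.
* §2 **`stub_R90_S4_U2_ldsRed_holds`** — the bytes of B ED. 5 :413–:425 (`_ldsRed`), PROVED; ED. 6 pay line `stub_R90_S4_U2_ldsRed := stub_R90_S4_U2_ldsRed_holds`.
HONEST LABEL: HC_CM is proved only modulo the 7 printed citations (2 remaining named inputs: hLiu418 = stmt-HodgeConjecture-24832,
h413 = stmt-HodgeConjecture-24833) until rung 0 closes; this file discharges the (RED)∕(DECOMP)∕(TWO) analytic input of socket LDS of S4's file B — the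
remaining S4 sub-sockets are (SWAP) [LL] and (HC1) [Harish-Chandra]; count-neutral until the B edition consumes it.  REL ≠ ★ ≠ BUILT.

## References
* [Rogawski1990] J. D. Rogawski, *Automorphic Representations of Unitary Groups in Three Variables*, Ann. of Math. Stud. 123 (1990), §11.1 p. 161, §12.1 p. 171.
* [Keys1984] D. Keys, *Principal series representations of special unitary groups over local fields*, Compositio Math. 51 (1984), §3, §7 Thm. (1).
* [Casselman1995] W. Casselman, *Introduction to the theory of admissible representations of 𝔭-adic reductive groups* (1995), §3.2, §6.3, §6.4, Lemma 7.1.1 (a).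
* [LabesseLanglands1979] J.-P. Labesse, R. P. Langlands, *L-indistinguishability for SL(2)*, Canad. J. Math. 31 (1979), 726–785.
* [BernsteinZelevinsky1976] I. N. Bernstein, A. V. Zelevinsky, Russian Math. Surveys 31:3 (1976), Prop. 2.28, 2.25 (c).
-/

set_option autoImplicit false
-- the mandated namespace (brief §3.4) repeats the single-problem summit's segment (`HodgeConjecture.HodgeConjecture`)
set_option linter.dupNamespace false

noncomputable section

open NumberField IsDedekindDomain MeasureTheory
open scoped Matrix MatrixGroups
open Literature.NumberTheory.Automorphic Literature.NumberTheory.Automorphic.UnitaryGroup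
open Summit.HodgeConjecture.HodgeConjecture.Cruxes.H413

namespace Summit.HodgeConjecture.HodgeConjecture.R90.S4

/-! ## §1 The second eigenfunctional at the l.d.s. point of `U(Φ₂)(L⁺_v)` -/

section CM

variable (L : Type) [Field L] [NumberField L] [IsCMField L] (v : HeightOneSpectrum (𝓞 ↥(maximalRealSubfield L)))
  (hns : ∀ w : PlacesOver L v, IsCMField.complexConj L • w.1 = w.1)

include hns in
set_option synthInstance.maxHeartbeats 400000 in
set_option maxHeartbeats 8000000 in
-- statement∕proof-heavy: the `SmoothInd` carrier of ★ `cmPrincipalSeries` (class of ★ (α) ∕ ★ (β))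
/-- **«KEYS (2) ANALYTIC HALF★» — the second eigenfunctional EXISTS at the l.d.s. point.**  `v` non-split, `χ₁, χ₂` continuous with `χ₁|F_v^× = ω_{E/F}`
(★ `IsQuadraticCharExtension`): `i_{U(Φ₂)}((χ₁, χ₂))` carries a `(B₂, χδ^{1/2})`-eigenfunctional not proportional to evaluation at `1` (★ (α) on the standard section
`f₀`, `r_{B₂}(m)[f₀] = χ(m)[f₀]` for all `m` by ★ (β) and ★ (ζ) FILE A with `μ = haar`, `w₀` of ★ `exists_weylElt_two`). [cite: Keys1984, §3; §7 Thm. (1)]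
[cite: Rogawski1990, §11.1 p. 161; §12.1 p. 171] [cite: Casselman1995, Lemma 7.1.1 (a), §6.4] -/
theorem hSecond_two_holds (χ₁ : (LocalRing L v)ˣ →* ℂˣ) (χ₂ : ↥(normOneUnits (conjLocal L (IsCMField.complexConj L) v)) →* ℂˣ)
    (h₁ : Continuous fun x => ((χ₁ x : ℂˣ) : ℂ)) (h₂ : Continuous fun x => ((χ₂ x : ℂˣ) : ℂ))
    (hq : IsQuadraticCharExtension (conjLocal L (IsCMField.complexConj L) v) χ₁) :
    haveI := locallyCompactSpace_cmBorelU L 2 v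
    ∃ ℓ : Representation.SmoothInd (cmBorelTriple L 2 v).P
        (Representation.twist (((Representation.trivial ℂ ↥(torusU (conjLocal L (IsCMField.complexConj L) v) (cmLocalForm L 2 v)) ℂ).twist
          (torusCharPair (conjLocal L (IsCMField.complexConj L) v) (cmLocalForm L 2 v) (cmLocalForm_eq_over L 2 v) 0 χ₁ χ₂)).comp
          (cmBorelTriple L 2 v).proj) (rootDeltaChar (cmBorelTriple L 2 v).P)) →ₗ[ℂ] ℂ,
      (∀ (p : ↥(cmBorelTriple L 2 v).P) (f : _),
        ℓ (cmPrincipalSeries L 2 v (torusCharPair (conjLocal L (IsCMField.complexConj L) v) (cmLocalForm L 2 v) (cmLocalForm_eq_over L 2 v) 0 χ₁ χ₂) p.1 f) =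
          ((torusCharPair (conjLocal L (IsCMField.complexConj L) v) (cmLocalForm L 2 v) (cmLocalForm_eq_over L 2 v) 0 χ₁ χ₂ ((cmBorelTriple L 2 v).proj p) : ℂˣ) : ℂ) *
            ((rootDeltaChar (cmBorelTriple L 2 v).P p : ℂˣ) : ℂ) * ℓ f) ∧
      ∀ c : ℂ, ∃ f, ℓ f ≠ c * f.toFun 1 := by
  haveI := locallyCompactSpace_cmBorelU L 2 v
  haveI : LocallyCompactSpace ↥(unitaryGroupOfForm (conjLocal L (IsCMField.complexConj L) v) (cmLocalForm L 2 v)) :=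
    locallyCompactSpace_local (IsCMField.complexConj L) 2 _ v
  haveI : LocallyCompactSpace ↥(cmBorelTriple L 2 v).N :=
    LineRing.locallyCompactSpace_unipotentU_two (conjLocal L (IsCMField.complexConj L) v) (cmLocalForm_eq_over L 2 v) (continuous_conjLocal L (IsCMField.complexConj L) v)
  letI : MeasurableSpace ↥(cmBorelTriple L 2 v).N := borel _
  haveI : BorelSpace ↥(cmBorelTriple L 2 v).N := ⟨rfl⟩
  obtain ⟨w⟩ : Nonempty (PlacesOver L v) := inferInstance
  have hw := hns w
  obtain ⟨w₀, hw₀⟩ := F0P3cU2PrincipalSeriesOpenCellTorusChar.exists_weylElt_two L v hns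
  have hw' := cmTwo_weylTorusCharPair_eq_of_isQuadraticCharExtension L v χ₁ χ₂ hq
  have hχc := continuous_torusCharPair_apply (conjLocal L (IsCMField.complexConj L) v) (cmLocalForm L 2 v) (cmLocalForm_eq_over L 2 v) 0 χ₁ χ₂ h₁ h₂
  obtain ⟨f₀, hf₀, -⟩ := exists_cmPrincipalSeries_toFun_one_eq_one L 2 v _ hχc
  exact secondEigenfunctional_of_one_vector_two L v hns χ₁ χ₂ h₁ h₂ hw' f₀ hf₀
    (pair_two_normalizedJacquet_mk_eq_smul_of_forall_integral_eq_zero L v hns χ₁ χ₂ h₁ h₂ w₀ hw₀ Measure.haar f₀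
      fun m => integral_cellFun_testVector_eq_zero_two L v hns χ₁ χ₂ w₀ hw₀ Measure.haar w hw h₁ hq hw' m f₀)

end CM

/-! ## §2 (RED): the sub-sub-socket `stub_R90_S4_U2_ldsRed` of B ED. 5, PROVED -/

set_option synthInstance.maxHeartbeats 400000 in
set_option maxHeartbeats 8000000 in
-- statement-heavy: `Subrepresentation (cmPrincipalSeries …)` under the socket's ∀-closed guards (class of ★ p862353)
/-- **(RED) — «THE UNITARY PRINCIPAL SERIES OF `U(1,1)` AT `χ₁|F^× = ω` IS REDUCIBLE», the bytes of the sub-sub-socket `stub_R90_S4_U2_ldsRed` of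
`Cruxes/H413/Lines/R90_S4_HPacketsU2B.lean` ED. 5 (:413–:425), PROVED**: at a non-split `v`, for `χ₁, χ₂` with open kernels (hence continuous ★
`continuous_unitsCoe_of_isOpen_ker`) and `χ₁|F_v^× = ω_{E/F}`, `i_{U(Φ₂)}((χ₁, χ₂))` has a `G`-stable `N` with `⊥ ≠ N ≠ ⊤` — §1 + ★ «KEYS-RED ⟸ SECOND EIGENFUNCTIONAL»
`exists_ne_bot_ne_top_of_eigenfunctional L 2 v`.  («`i_H(χ)` is irreducible except … 2) `χ₁|F* = ω_{E/F}` … `JH(i_H(χ))` is an l.d.s. L-packet».)  ED. 6 pay line: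
`stub_R90_S4_U2_ldsRed := stub_R90_S4_U2_ldsRed_holds`. [cite: Rogawski1990, §12.1 p. 171 case 2); §11.1 p. 161] [cite: Keys1984, §3, §7]
[cite: BernsteinZelevinsky1976, Proposition 2.28] -/
theorem stub_R90_S4_U2_ldsRed_holds :
    ∀ (L : Type) [Field L] [NumberField L] [IsCMField L] (v : HeightOneSpectrum (𝓞 ↥(maximalRealSubfield L))),
      (∀ w : PlacesOver L v, IsCMField.complexConj L • w.1 = w.1) →
      ∀ (χ₁ : (LocalRing L v)ˣ →* ℂˣ) (χ₂ : ↥(normOneUnits (conjLocal L (IsCMField.complexConj L) v)) →* ℂˣ),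
        IsOpen ((χ₁.ker : Subgroup (LocalRing L v)ˣ) : Set (LocalRing L v)ˣ) →
        IsOpen ((χ₂.ker : Subgroup ↥(normOneUnits (conjLocal L (IsCMField.complexConj L) v))) :
          Set ↥(normOneUnits (conjLocal L (IsCMField.complexConj L) v))) →
        IsQuadraticCharExtension (conjLocal L (IsCMField.complexConj L) v) χ₁ →
        ∃ N : Subrepresentation (cmPrincipalSeries L 2 v
            (torusCharPair (conjLocal L (IsCMField.complexConj L) v) (cmLocalForm L 2 v) (cmLocalForm_eq_over L 2 v) 0 χ₁ χ₂)),
          N ≠ ⊥ ∧ N ≠ ⊤ :=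
  fun L _ _ _ v hv χ₁ χ₂ hχ₁ hχ₂ hq => by
    haveI := locallyCompactSpace_cmBorelU L 2 v
    obtain ⟨ℓ, hℓ, hind⟩ := hSecond_two_holds L v hv χ₁ χ₂ (continuous_unitsCoe_of_isOpen_ker χ₁ hχ₁) (continuous_unitsCoe_of_isOpen_ker χ₂ hχ₂) hq
    exact F0P3cStCharTSRedOfEigenfunctional.exists_ne_bot_ne_top_of_eigenfunctional L 2 v _ ℓ hℓ hind

end Summit.HodgeConjecture.HodgeConjecture.R90.S4

end
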